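import Summits.CriticalPhenomena.PercolationContinuityZ3.Theorems.PercNearOneGluingNoHeavyQuantTopTwoCore
import Summits.CriticalPhenomena.PercolationContinuityZ3.Theorems.PercNearOneGluingNoHeavyQuantGateMoveBlobCells
import HarnessLib

/-!
# QUANT lane R8, T-DEC: FORESTS OF LIGHT SIBLINGS ARE SDEC, k-GENERAL — I. the light hub-core, finite same-mean mixtures, and the
# branches of the induction step (arm-1 gen 56, architect)

builds on p205010 (kernel theorem, internal audit signed; external expert review pending)

Support file (`--supports stmt-CriticalPhenomena-4575`), QUANT lane seat prim-quant-arm-1 (gen 56, architect); memo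
`run/shared/lean/prim/quant/prim-quant-arm-1-g56/ARCH-G56.md` §3.  Theorems only (file-local notation, no definitions); standard axioms, no
sorries.  Consumer: `…QuantLightSiblingForest` — **every forest of LIGHT siblings (`qᵢ·mean ρᵢ ≤ 2·h` for every charged relay count
`h ≥ 1` of `ρᵢ`; in particular every sibling with `qᵢ·mean ρᵢ ≤ 2`: all 2-chains, all mean-light siblings, every `R[q](F)` with
`q·(1 + mean F) ≤ 2`), ANY WIDTH, ANY SUB-FOREST SHAPES, is SDEC at every per-sibling-affordable floor `x·Mᵢ ≤ qᵢ·mean ρᵢ` (every tree-OK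
floor) — no oracle, no certificate.**

THE MECHANISM.  Replace each sibling's gated law `t` (mean `m`, declared top `M`, `x·M ≤ m`) by the canonical same-mean two-point
decomposition of Lemma P (`exists_twoPoint_decomposition_TA`): components `{lo, hi; γ}` on charged atoms, `lo + (hi − lo)γ = m`.  SDEC is
convex along same-mean mixtures (`sdec_of_mixture_finset`, from `decAtT_mixture_finset`).  A component with `lo = 0` is a gated blob of gate
`γ = m/hi ≥ m/M ≥ x`: a SLICE (`sdec_slice_blob_of_mixLaw'` + `gatedSliceMixLaw'_holds`; `sdec_lconv_lconv_blob'`).  A component with `lo ≥ 1`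
is `lo` sure relays + a blob of size `K = hi − lo` at gate `γ` (possibly BELOW the floor); it is LIGHT when `K·γ = m − lo ≤ lo` — automatic when
`m ≤ 2·lo`, i.e. for light siblings.  Light components join the HUB-CORE `flaw HC[cs]` = law of `Σ lo_j + Σ K_j·Bern(γ_j)`: every positive atom
is `≥ Σ lo_j ≥ (Σ lo_j + Σ K_jγ_j)/2 ≥ T/2` at every gate, so the core has NO positive low atom and is DEC at every layer by the moment
criterion `decAt_all_of_noLow` (`sdec_hubCore_light`; top-affordable since `x(lo_j + K_j) ≤ lo_j + K_jγ_j`).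

* `sdec_of_mixture_finset`; `tpLaw_apply`, `hs_facts`; `ftop_hubCore`, `flaw_hubCore_cons`, `hubCore_facts`, `hubCore_bounds`, **`sdec_hubCore_light`**;
* `sum_range_top_mono`; `lconv_lconv_right_comm'`; `sdec_lconv_lconv_blob'` (blob branch, any declared top), `sdec_lconv_lconv_delta` (empty
  component), `sdec_lconv_lconv_toCore` (core branch with top padding).

HONEST STATUS.  Tools; the sibling step (`SiblingStep` / `GateStepN` / `LightResidDECOracle` / `FarTreeRow`) stays OPEN for forests with a
HEAVY sibling (`qᵢ·mean ρᵢ > 2·(least relay count)`): there the canonical decomposition produces far-giant components `{lo, hi; γ}` with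
`γ < x`, `(hi−lo)γ > lo`, which violate the FAR row on their own (memo §2); RATE class (log\*) / honest sentence of
`run/shared/lean/prim/quant/README.md` unchanged.  [this work].  Extreme points of moment sets: classical; nothing here is cited as a published
result.  The gluing rows served [cite: KozmaNitzan2024, Conjecture 3 (p. 15)]; product measure [cite: Grimmett1999, §1.3 p. 10].
-/

noncomputable section

open scoped BigOperators

namespace Summit.CriticalPhenomena.PercolationContinuityZ3.Theorems
namespace Quant
namespace LawDec

open Finset

/-- the point mass `δ_K` -/
local notation3 "δ[" K "]" => (fun k : ℕ => if k = (K : ℕ) then (1 : ℝ) else 0)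

/-- the two-point law `{lo, lo+K; g}` = `lo` sure relays and a blob of size `K` at gate `g` -/
local notation3 "TPL[" lo ", " K ", " g "]" => lconv lo K δ[lo] (gate δ[K] g)

/-- the two-point law as a pseudo-sibling with the sure root gate `1` (data only; `flaw` does not need `q < 1`) -/
local notation3 "HS[" lo ", " K ", " g "]" => (⟨1, 0, 0, lo + K, TPL[lo, K, g]⟩ : Sib)

/-- **the hub-core** of elements `(lo, K, γ)`: the pseudo-sibling list whose forest law is the law of `Σ lo_j + Σ K_j·Bern(γ_j)` -/
local notation3 "HC[" cs "]" => List.map (fun c : ℕ × ℕ × ℝ => HS[c.1, c.2.1, c.2.2]) cs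

/-! ### Finite same-mean mixtures -/

/-- **SDEC IS CONVEX ALONG FINITE SAME-MEAN MIXTURES**: if `μ = Σ_{i ∈ s} w_i·ν_i` with weights `w ≥ 0`, `Σ w = 1`, and every CHARGED `ν_i` has
mean `m` and is SDEC at `x` on `{0..N}`, then `μ` is SDEC at `x` (`decAtT_mixture_finset` at the common target `a·m`). [this work] -/
theorem sdec_of_mixture_finset {ι : Type*} (s : Finset ι) (w : ι → ℝ) (ν : ι → ℕ → ℝ) (x m : ℝ) (N : ℕ)
    (hw0 : ∀ i ∈ s, 0 ≤ w i) (hw1 : ∑ i ∈ s, w i = 1)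
    (hmean : ∀ i ∈ s, 0 < w i → ∑ h ∈ Finset.range (N + 1), (h : ℝ) * ν i h = m)
    (hS : ∀ i ∈ s, 0 < w i → SDEC x N (ν i)) :
    SDEC x N (fun h => ∑ i ∈ s, w i * ν i h) := by
  intro a ha0 ha1 j hj
  rw [decAt_iff_decAtT]
  have hwm : ∀ i ∈ s, w i * ∑ h ∈ Finset.range (N + 1), (h : ℝ) * ν i h = w i * m := by
    intro i hi
    rcases (hw0 i hi).eq_or_lt with hz | hpos
    · rw [← hz, zero_mul, zero_mul]
    · rw [hmean i hi hpos]
  have hgate : gate (fun h => ∑ i ∈ s, w i * ν i h) a = fun h => ∑ i ∈ s, w i * gate (ν i) a h := by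
    funext h
    have e : ∀ i ∈ s, w i * gate (ν i) a h = a * (w i * ν i h) + w i * ((1 - a) * (if h = 0 then (1 : ℝ) else 0)) :=
      fun i _ => by rw [gate_apply]; ring
    rw [Finset.sum_congr rfl e, Finset.sum_add_distrib, ← Finset.mul_sum, ← Finset.sum_mul, hw1, one_mul, gate_apply]
  have emean : ∑ h ∈ Finset.range (N + 1), (h : ℝ) * gate (fun h => ∑ i ∈ s, w i * ν i h) a h = a * m := by
    rw [sum_mul_gate]
    have e : ∑ h ∈ Finset.range (N + 1), (h : ℝ) * ∑ i ∈ s, w i * ν i h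
        = ∑ i ∈ s, w i * ∑ h ∈ Finset.range (N + 1), (h : ℝ) * ν i h := by
      simp only [Finset.mul_sum]
      rw [Finset.sum_comm]
      exact Finset.sum_congr rfl fun i _ => Finset.sum_congr rfl fun h _ => by ring
    rw [e, Finset.sum_congr rfl hwm, ← Finset.sum_mul, hw1, one_mul]
  rw [emean, hgate]
  exact decAtT_mixture_finset s w (fun i => gate (ν i) a) hw0 hw1 fun i hi hwi => by
    have d := hS i hi hwi a ha0 ha1 j hj
    rw [decAt_iff_decAtT, sum_mul_gate, hmean i hi hwi] at d
    exact d

/-! ### The two-point law and the hub-core -/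

/-- the two-point law pointwise: `TPL[lo, K, g] h = g·[h = lo+K] + (1−g)·[h = lo]`. [this work] -/
theorem tpLaw_apply (lo K : ℕ) (g : ℝ) (h : ℕ) :
    (TPL[lo, K, g]) h = g * (if h = lo + K then (1 : ℝ) else 0) + (1 - g) * (if h = lo then (1 : ℝ) else 0) := by
  rw [lconv_gate_point_eq_slice lo K _ g (fun k hk => if_neg (by omega))]
  simp only [slice]
  have e : (if K ≤ h then (if h - K = lo then (1 : ℝ) else 0) else 0) = (if h = lo + K then (1 : ℝ) else 0) := by
    split_ifs <;> first | rfl | omega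
  rw [e]; ring

/-- law facts of the two-point law (`0 ≤ g ≤ 1`): nonnegative, vanishing above `lo + K`, mass `1` and mean `lo + K·g` on `{0..lo+K}`, no atom
below `lo`. [this work] -/
theorem hs_facts (lo K : ℕ) (g : ℝ) (hg0 : 0 ≤ g) (hg1 : g ≤ 1) :
    (∀ h, 0 ≤ (TPL[lo, K, g]) h) ∧ (∀ h, lo + K < h → (TPL[lo, K, g]) h = 0) ∧
    (∑ h ∈ Finset.range (lo + K + 1), (TPL[lo, K, g]) h = 1) ∧
    (∑ h ∈ Finset.range (lo + K + 1), (h : ℝ) * (TPL[lo, K, g]) h = lo + K * g) ∧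
    (∀ h, h < lo → (TPL[lo, K, g]) h = 0) := by
  obtain ⟨d0, dM, d1⟩ := gate_laws K δ[K] g hg0 hg1 (fun h => by positivity) (fun h hh => if_neg (by omega)) (by simp)
  have dmn : ∑ h ∈ Finset.range (K + 1), (h : ℝ) * gate δ[K] g h = g * K := by rw [sum_mul_gate]; simp
  have p0 : ∀ h, 0 ≤ (δ[lo]) h := fun h => by positivity
  have p1 : ∑ h ∈ Finset.range (lo + 1), (δ[lo]) h = 1 := by simp
  have pmn : ∑ h ∈ Finset.range (lo + 1), (h : ℝ) * (δ[lo]) h = lo := by simp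
  refine ⟨lconv_nonneg _ _ _ _ p0 d0, fun h hh => lconv_eq_zero _ _ _ _ h hh, sum_lconv _ _ _ _ p1 d1,
    by rw [sum_mul_lconv _ _ _ _ p1 d1, pmn, dmn]; ring, fun h hh => ?_⟩
  rw [tpLaw_apply, if_neg (by omega), if_neg (by omega)]; ring

/-- the hub-core has top `Σ (lo_j + K_j)`. [this work] -/
theorem ftop_hubCore : ∀ cs : List (ℕ × ℕ × ℝ), ftop HC[cs] = (cs.map fun c => c.1 + c.2.1).sum
  | [] => rfl
  | c :: cs => by simp only [List.map_cons, ftop, List.sum_cons, ftop_hubCore cs]; ring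

/-- the hub-core law unfolds as the convolution of its two-point laws. [this work] -/
theorem flaw_hubCore_cons (c : ℕ × ℕ × ℝ) (cs : List (ℕ × ℕ × ℝ)) :
    flaw HC[c :: cs] = lconv (ftop HC[cs]) (c.1 + c.2.1) (flaw HC[cs]) (TPL[c.1, c.2.1, c.2.2]) := by
  simp only [List.map_cons, flaw, gate_one]

/-- **law facts of the hub-core** (`0 ≤ γ_j ≤ 1`): nonnegative, vanishing above its top, mass `1`, mean `Σ (lo_j + K_jγ_j)`, and NO atom below
`Σ lo_j` (every configuration reaches the sure relays). [this work] -/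
theorem hubCore_facts : ∀ cs : List (ℕ × ℕ × ℝ), (∀ c ∈ cs, 0 ≤ c.2.2 ∧ c.2.2 ≤ 1) →
    (∀ h, 0 ≤ flaw HC[cs] h) ∧ (∀ h, ftop HC[cs] < h → flaw HC[cs] h = 0) ∧
    (∑ h ∈ Finset.range (ftop HC[cs] + 1), flaw HC[cs] h = 1) ∧
    (∑ h ∈ Finset.range (ftop HC[cs] + 1), (h : ℝ) * flaw HC[cs] h = (cs.map fun c => (c.1 : ℝ) + c.2.1 * c.2.2).sum) ∧
    (∀ h, h < (cs.map fun c => c.1).sum → flaw HC[cs] h = 0)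
  | [], _ => by
    refine ⟨fun h => ?_, fun h hh => ?_, by simp [flaw, ftop], by simp [flaw, ftop], fun h hh => by simp at hh⟩
    · simp only [List.map_nil, flaw]; split_ifs <;> norm_num
    · simp only [List.map_nil, flaw, ftop] at hh ⊢; rw [if_neg (by omega)]
  | c :: cs, hcs => by
    obtain ⟨c0, cM, c1, cmn, clow⟩ := hubCore_facts cs (fun c' hc' => hcs c' (List.mem_cons_of_mem c hc'))
    obtain ⟨hg0, hg1⟩ := hcs c List.mem_cons_self
    obtain ⟨l0, lM, l1, lmn, lz⟩ := hs_facts c.1 c.2.1 c.2.2 hg0 hg1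
    have e : ftop HC[c :: cs] = ftop HC[cs] + (c.1 + c.2.1) := by simp only [List.map_cons, ftop]
    rw [e, flaw_hubCore_cons]
    simp only [List.map_cons, List.sum_cons]
    refine ⟨fun h => lconv_nonneg _ _ _ _ c0 l0 h, fun h hh => lconv_eq_zero _ _ _ _ h (by omega),
      by simpa only [Nat.add_assoc] using sum_lconv _ _ _ _ c1 l1, ?_, fun h hh => ?_⟩
    · have hm := sum_mul_lconv _ _ _ _ c1 l1
      rw [cmn, lmn] at hm
      simp only [Nat.add_assoc] at hm ⊢
      rw [hm]; ring
    · change (∑ i ∈ Finset.range (ftop HC[cs] + 1), ∑ k ∈ Finset.range (c.1 + c.2.1 + 1),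
        if i + k = h then flaw HC[cs] i * (TPL[c.1, c.2.1, c.2.2]) k else 0) = 0
      refine Finset.sum_eq_zero fun i _ => Finset.sum_eq_zero fun k _ => ?_
      split_ifs with hik
      · by_cases hk : k < c.1
        · rw [lz k hk, mul_zero]
        · rw [clow i (by omega), zero_mul]
      · rfl

/-- bounds for a LIGHT hub-core (`K_jγ_j ≤ lo_j`, `x(lo_j + K_j) ≤ lo_j + K_jγ_j`): `x·top ≤ mean ≤ 2·Σ lo_j`. [this work] -/
theorem hubCore_bounds (x : ℝ) : ∀ cs : List (ℕ × ℕ × ℝ), (∀ c ∈ cs, (c.2.1 : ℝ) * c.2.2 ≤ c.1) →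
    (∀ c ∈ cs, x * ((c.1 : ℝ) + c.2.1) ≤ c.1 + c.2.1 * c.2.2) →
    x * (((cs.map fun c => c.1 + c.2.1).sum : ℕ) : ℝ) ≤ (cs.map fun c => (c.1 : ℝ) + c.2.1 * c.2.2).sum ∧
    (cs.map fun c => (c.1 : ℝ) + c.2.1 * c.2.2).sum ≤ 2 * (((cs.map fun c => c.1).sum : ℕ) : ℝ)
  | [], _, _ => by simp
  | c :: cs, h1, h2 => by
    obtain ⟨ih1, ih2⟩ := hubCore_bounds x cs (fun c' hc' => h1 c' (List.mem_cons_of_mem c hc'))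
      (fun c' hc' => h2 c' (List.mem_cons_of_mem c hc'))
    have hc1 := h1 c List.mem_cons_self
    have hc2 := h2 c List.mem_cons_self
    simp only [List.map_cons, List.sum_cons, Nat.cast_add] at *
    constructor <;> linarith

/-- **A LIGHT HUB-CORE IS SDEC** at every floor `0 < x < 1`: elements `(lo_j, K_j, γ_j)` with `0 ≤ γ_j ≤ 1`, LIGHT (`K_jγ_j ≤ lo_j`) and affordable
(`x(lo_j + K_j) ≤ lo_j + K_jγ_j`).  At gate `a` every positive atom is `≥ Σ lo_j ≥ mean/2 ≥ T/2` — no positive low atom — and the law is top-affordable,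
so the moment criterion `decAt_all_of_noLow` gives DEC at every layer.  Blob gates below the floor included. [this work] -/
theorem sdec_hubCore_light {x : ℝ} (hx0 : 0 < x) (hx1 : x < 1) (cs : List (ℕ × ℕ × ℝ))
    (hg : ∀ c ∈ cs, 0 ≤ c.2.2 ∧ c.2.2 ≤ 1) (hlight : ∀ c ∈ cs, (c.2.1 : ℝ) * c.2.2 ≤ c.1)
    (haff : ∀ c ∈ cs, x * ((c.1 : ℝ) + c.2.1) ≤ c.1 + c.2.1 * c.2.2) : SDEC x (ftop HC[cs]) (flaw HC[cs]) := by
  intro a ha0 ha1 j hj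
  obtain ⟨c0, cM, c1, cmn, clow⟩ := hubCore_facts cs hg
  obtain ⟨hb1, hb2⟩ := hubCore_bounds x cs hlight haff
  obtain ⟨g0, gM, g1⟩ := gate_laws (ftop HC[cs]) (flaw HC[cs]) a ha0.le ha1 c0 cM c1
  have gmn : ∑ h ∈ Finset.range (ftop HC[cs] + 1), (h : ℝ) * gate (flaw HC[cs]) a h
      = a * (cs.map fun c => (c.1 : ℝ) + c.2.1 * c.2.2).sum := by rw [sum_mul_gate, cmn]
  have hax0 : 0 < a * x := mul_pos ha0 hx0
  have hax1 : a * x < 1 := by nlinarith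
  have htop : ftop HC[cs] = (cs.map fun c => c.1 + c.2.1).sum := ftop_hubCore cs
  have hmean0 : 0 ≤ (cs.map fun c => (c.1 : ℝ) + c.2.1 * c.2.2).sum :=
    le_trans (mul_nonneg hx0.le (Nat.cast_nonneg _)) hb1
  refine decAt_all_of_noLow (a * x) (ftop HC[cs]) (gate (flaw HC[cs]) a) hax0 hax1 g0 gM g1 ?_ ?_ j hj
  · rw [gmn, htop]
    have := mul_le_mul_of_nonneg_left hb1 ha0.le
    nlinarith
  · intro h h1 hpos
    rw [gmn]
    have hch : flaw HC[cs] h ≠ 0 := by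
      intro hz; rw [gate_apply, hz, if_neg (by omega)] at hpos; simp at hpos
    have hnh : (cs.map fun c => c.1).sum ≤ h := by
      by_contra hlt; exact hch (clow h (not_le.1 hlt))
    have hnh' : (((cs.map fun c => c.1).sum : ℕ) : ℝ) ≤ h := by exact_mod_cast hnh
    nlinarith

/-! ### The branches of the induction step, generically -/

/-- widening the range of a mass sum (the law vanishes above `M ≤ M′`). [this work] -/
theorem sum_range_top_mono (M M' : ℕ) (hMM : M ≤ M') (μ : ℕ → ℝ) (hμM : ∀ h, M < h → μ h = 0) :
    ∑ h ∈ Finset.range (M' + 1), μ h = ∑ h ∈ Finset.range (M + 1), μ h := by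
  have e := sum_range_widen M M' hMM μ hμM (fun _ => (1 : ℝ))
  simpa using e

/-- `α ∗ (β ∗ C) = (α ∗ C) ∗ β` with the tops `N`, `B`, `H`. [this work] -/
theorem lconv_lconv_right_comm' (N B H : ℕ) (α β C : ℕ → ℝ) :
    lconv N (B + H) α (lconv B H β C) = lconv (N + H) B (lconv N H α C) β := by
  rw [lconv_comm B H β C, Nat.add_comm B H, lconv_assoc]

/-- **the blob branch**: for laws `α` on `{0..N}`, `β` on `{0..B}` with `α ∗ β` a probability law, top-affordable and SDEC at `x`, a blob
`gate δ_K g` of size `1 ≤ K ≤ M` with `x ≤ g ≤ 1` and `x·M ≤ g·K`: `α ∗ (β ∗ gate_g δ_K)` (the sibling slot declared on `{0..M}`) is SDEC at `x` on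
`{0..N+B+M}` — a slice of `α ∗ β` (`sdec_slice_blob_of_mixLaw'` with `gatedSliceMixLaw'_holds`), then `sdec_mono_top`-style padding. [this work] -/
theorem sdec_lconv_lconv_blob' {x g : ℝ} {N B K M : ℕ} {α β : ℕ → ℝ} (hx0 : 0 < x) (hx1 : x < 1) (hxg : x ≤ g) (hg1 : g ≤ 1)
    (hK1 : 1 ≤ K) (hKM : K ≤ M) (hpad : x * (M : ℝ) ≤ g * (K : ℝ))
    (a0 : ∀ h, 0 ≤ lconv N B α β h) (aM : ∀ h, N + B < h → lconv N B α β h = 0)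
    (a1 : ∑ h ∈ Finset.range (N + B + 1), lconv N B α β h = 1)
    (ata : x * ((N + B : ℕ) : ℝ) ≤ ∑ h ∈ Finset.range (N + B + 1), (h : ℝ) * lconv N B α β h)
    (hS : SDEC x (N + B) (lconv N B α β)) :
    SDEC x (N + (B + M)) (lconv N (B + M) α (lconv B M β (gate δ[K] g))) := by
  have hg0 : 0 ≤ g := hx0.le.trans hxg
  obtain ⟨d0, dM, d1⟩ := gate_laws K δ[K] g hg0 hg1 (fun h => by positivity) (fun h hh => if_neg (by omega)) (by simp)
  have dmn : ∑ h ∈ Finset.range (K + 1), (h : ℝ) * gate δ[K] g h = g * K := by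
    rw [sum_mul_gate]; simp
  have e1 : lconv N (B + M) α (lconv B M β (gate δ[K] g)) = lconv (N + B) K (lconv N B α β) (gate δ[K] g) := by
    have e0 : lconv B M β (gate δ[K] g) = lconv B K β (gate δ[K] g) := funext fun h => lconv_top_right_of_le _ K M _ _ hKM dM h
    rw [e0]
    have e2 : lconv N (B + M) α (lconv B K β (gate δ[K] g)) = lconv N (B + K) α (lconv B K β (gate δ[K] g)) :=
      funext fun h => lconv_top_right_of_le _ (B + K) (B + M) _ _ (by omega) (fun k hk => lconv_eq_zero _ _ _ _ k hk) h
    rw [e2, lconv_assoc]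
  rw [e1]
  have h1 : SDEC x (N + B + K) (lconv (N + B) K (lconv N B α β) (gate δ[K] g)) := by
    rw [lconv_gate_point_eq_slice _ K _ g aM]
    exact sdec_slice_blob_of_mixLaw' gatedSliceMixLaw'_holds x g (N + B) K _ hx0 hx1 hxg hg1 hK1 a0 aM a1 ata hS
  -- raise the declared top from `N+B+K` to `N+(B+M)`
  refine sdec_mono_top hx0 hx1 (lconv_nonneg _ _ _ _ a0 d0) (fun h hh => lconv_eq_zero _ _ _ _ h hh) (sum_lconv _ _ _ _ a1 d1)
    (by omega) ?_ h1
  rw [sum_mul_lconv _ _ _ _ a1 d1, dmn]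
  have hKM' : (K : ℝ) ≤ M := by exact_mod_cast hKM
  push_cast at ata ⊢
  nlinarith

/-- **the empty component** (`lo = hi = 0`, the law `δ₀`): `α ∗ (β ∗ δ₀)` on `{0..N+B+M}` is `α ∗ β` with a raised top. [this work] -/
theorem sdec_lconv_lconv_delta {x : ℝ} {N B M : ℕ} {α β : ℕ → ℝ} (hx0 : 0 < x) (hx1 : x < 1) (bM : ∀ h, B < h → β h = 0)
    (a0 : ∀ h, 0 ≤ lconv N B α β h) (aM : ∀ h, N + B < h → lconv N B α β h = 0)
    (a1 : ∑ h ∈ Finset.range (N + B + 1), lconv N B α β h = 1)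
    (ata : x * ((N + (B + M) : ℕ) : ℝ) ≤ ∑ h ∈ Finset.range (N + B + 1), (h : ℝ) * lconv N B α β h)
    (hS : SDEC x (N + B) (lconv N B α β)) :
    SDEC x (N + (B + M)) (lconv N (B + M) α (lconv B M β δ[0])) := by
  have e0 : lconv B M β δ[0] = β := funext fun h => lconv_delta_right _ _ _ bM h
  have e1 : lconv N (B + M) α β = lconv N B α β := funext fun h => lconv_top_right_of_le _ B (B + M) _ _ (by omega) bM h
  rw [e0, e1]
  exact sdec_mono_top hx0 hx1 a0 aM a1 (by omega) ata hS

/-- **the core branch**: if `(α ∗ C) ∗ β` is SDEC at `x` on `{0..N+H+B}` — `C` a probability law on `{0..H}`, the enlarged core `α ∗ C` beside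
the forest `β` — then `α ∗ (β ∗ C)` with the sibling slot declared on `{0..M}`, `H ≤ M`, is SDEC at `x` on `{0..N+B+M}` (bookkeeping
`lconv_lconv_right_comm'` and a raised top; affordability `x·(N+B+M) ≤ mean`). [this work] -/
theorem sdec_lconv_lconv_toCore {x : ℝ} {N B H M : ℕ} {α β C : ℕ → ℝ} (hx0 : 0 < x) (hx1 : x < 1) (hHM : H ≤ M)
    (α0 : ∀ h, 0 ≤ α h) (α1 : ∑ h ∈ Finset.range (N + 1), α h = 1)
    (β0 : ∀ h, 0 ≤ β h) (β1 : ∑ h ∈ Finset.range (B + 1), β h = 1)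
    (C0 : ∀ h, 0 ≤ C h) (CM : ∀ h, H < h → C h = 0) (C1 : ∑ h ∈ Finset.range (H + 1), C h = 1)
    (ata : x * ((N + (B + M) : ℕ) : ℝ) ≤ ∑ h ∈ Finset.range (N + 1), (h : ℝ) * α h + ∑ h ∈ Finset.range (B + 1), (h : ℝ) * β h
      + ∑ h ∈ Finset.range (H + 1), (h : ℝ) * C h)
    (hS : SDEC x (N + H + B) (lconv (N + H) B (lconv N H α C) β)) :
    SDEC x (N + (B + M)) (lconv N (B + M) α (lconv B M β C)) := by
  have e0 : lconv B M β C = lconv B H β C := funext fun h => lconv_top_right_of_le _ H M _ _ hHM CM h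
  have e1 : lconv N (B + M) α (lconv B H β C) = lconv N (B + H) α (lconv B H β C) :=
    funext fun h => lconv_top_right_of_le _ (B + H) (B + M) _ _ (by omega) (fun k hk => lconv_eq_zero _ _ _ _ k hk) h
  rw [e0, e1, lconv_lconv_right_comm']
  have ac0 : ∀ h, 0 ≤ lconv N H α C h := lconv_nonneg _ _ _ _ α0 C0
  have ac1 := sum_lconv _ _ _ _ α1 C1
  refine sdec_mono_top hx0 hx1 (lconv_nonneg _ _ _ _ ac0 β0) (fun h hh => lconv_eq_zero _ _ _ _ h hh) (sum_lconv _ _ _ _ ac1 β1)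
    (by omega) ?_ hS
  rw [sum_mul_lconv _ _ _ _ ac1 β1, sum_mul_lconv _ _ _ _ α1 C1]
  linarith

end LawDec
end Quant
end Summit.CriticalPhenomena.PercolationContinuityZ3.Theorems
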